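import Mathlib.Tactic
import HarnessLib
import HarnessLib.Audit.Tags

/-!
# Purely inseparable four-folds — THE PURE-CORNER DRIFT ON FOUR LETTERS: the register potential `(Σδ)² − 3 Σδ²`
# (cell `res-dim4-pi`, K2(p) lane; companion of `…ResConePureCornerDrift`, which does two and three letters)

[OURS · counted 0 · cell `res-dim4-pi` · K2(p) lane (holder res-dim4-p-12 g5) · seat res-dim4-p-5 g6.]  Nothing here proves any TAIL(p, d, e),
K2(7), K2(p), `NoIsolatedTrap p p` or resolution of singularities in dimension ≥ 4 / characteristic `p` — NOT proved; pure integer bookkeeping.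
AI kernel work, weaker than expert review.

THE DYNAMICS (as in `…PureCornerDrift`): a word `j` over letters, integers `δ t l`; charting `i` FIXES `δ_i` and ADDS `δ_i` to every other
`δ_l`.  With `m` active letters the REGISTERS `r_l := w − δ_l`, `w := Σδ/(m−1)`, move by `r_i ← Σ_l r_l`, and the second elementary symmetric
function `e₂(r)` grows by `δ_i²` at a step charting `i`; it is NEGATIVE on every MIXED state (some `δ ≤ −1`, some `δ ≥ 1`): if `w ≥ 0` the
register of the negative letter is `≥ w + 1`, if `w < 0` the register of the positive letter is `≤ w − 1`, either square exceeds `w²`.  For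
four letters, cleared of denominators: `H₄ := (Σδ)² − 3 Σδ²` (`= 6 e₂`), increment `6 δ_i²`, and `3 H₄ = W² − Σ_l (W − 3δ_l)²` with
`W = Σδ`.
* `pureCorner_potential_four_neg` — `H₄ ≤ −1` on mixed states;
* **`pureCorner_drift_four`** — a word over four distinct letters each occurring infinitely often, `δ` bounded below ⟹ eventually all
  four `δ ≥ 0`.
With `…PureCornerDrift` this covers every number of chart letters `≥ 2`; the chain-level theorem «NO isolated witnessed `Step0 p` chain is
eventually pure-corner» is `…ResConePureCornerTail`.
[cite: CossartJannsenSaito2020, Lemma 13.2, Lemma 13.4, Thm. 13.7] [cite: Hauser2010, §§F–G (chart expressions of a point blowup)]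
bears_on: LADDER-RESOLUTION:D157-DOOR2 (res-dim4-pi · K2(p) B rows · pure-corner drift, four letters).  Supports stmt-ResolutionOfSingularities-16155
(helper).
-/

set_option linter.dupNamespace false -- mandated namespace of this single-conjunct summit

namespace Summit.ResolutionOfSingularities.ResolutionOfSingularities.Theorems.PIDim4

namespace ResCone

/-- The four-letter register potential is negative on MIXED states: `x ≤ −1`, `y ≥ 1` ⟹ `(x+y+z+u)² − 3(x²+y²+z²+u²) ≤ −1`
(`3·` it `= W² − Σ (W − 3·)²`, `W` the sum; the square of the letter on the far side of `W/3` exceeds `W²`). [folklore] -/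
theorem pureCorner_potential_four_neg {x y z u : ℤ} (hx : x ≤ -1) (hy : 1 ≤ y) :
    (x + y + z + u) ^ 2 - 3 * (x ^ 2 + y ^ 2 + z ^ 2 + u ^ 2) ≤ -1 := by
  have key : 3 * ((x + y + z + u) ^ 2 - 3 * (x ^ 2 + y ^ 2 + z ^ 2 + u ^ 2)) =
      (x + y + z + u) ^ 2 - ((x + y + z + u - 3 * x) ^ 2 + (x + y + z + u - 3 * y) ^ 2 +
        (x + y + z + u - 3 * z) ^ 2 + (x + y + z + u - 3 * u) ^ 2) := by ring
  by_cases hW : 0 ≤ x + y + z + u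
  · nlinarith [sq_nonneg (x + y + z + u - 3 * y), sq_nonneg (x + y + z + u - 3 * z), sq_nonneg (x + y + z + u - 3 * u),
      sq_nonneg (x + y + z + u)]
  · nlinarith [sq_nonneg (x + y + z + u - 3 * x), sq_nonneg (x + y + z + u - 3 * z), sq_nonneg (x + y + z + u - 3 * u),
      sq_nonneg (x + y + z + u)]

/-- **PURE-CORNER DRIFT ON FOUR LETTERS.**  A word `j` over four distinct letters `a, b, c, e`, each occurring beyond every time; integer data
`δ t l` with `δ (t+1) (j t) = δ t (j t)` and `δ (t+1) l = δ t l + δ t (j t)` for `l ≠ j t`; the four `δ t ·` bounded below.  Then from some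
time on all four are `≥ 0`. [OURS] [cite: CossartJannsenSaito2020, Lemma 13.4] -/
theorem pureCorner_drift_four {j : ℕ → Fin 4} {a b c e : Fin 4} (hab : a ≠ b) (hac : a ≠ c) (hae : a ≠ e) (hbc : b ≠ c)
    (hbe : b ≠ e) (hce : c ≠ e) (hj : ∀ t, j t = a ∨ j t = b ∨ j t = c ∨ j t = e)
    (ha : ∀ T, ∃ t, T ≤ t ∧ j t = a) (hb : ∀ T, ∃ t, T ≤ t ∧ j t = b) (hc : ∀ T, ∃ t, T ≤ t ∧ j t = c)
    (he : ∀ T, ∃ t, T ≤ t ∧ j t = e) {δ : ℕ → Fin 4 → ℤ} (hfix : ∀ t, δ (t + 1) (j t) = δ t (j t))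
    (hadd : ∀ t l, l ≠ j t → δ (t + 1) l = δ t l + δ t (j t)) {B : ℤ}
    (hB : ∀ t, B ≤ δ t a ∧ B ≤ δ t b ∧ B ≤ δ t c ∧ B ≤ δ t e) :
    ∃ T, ∀ t, T ≤ t → 0 ≤ δ t a ∧ 0 ≤ δ t b ∧ 0 ≤ δ t c ∧ 0 ≤ δ t e := by
  -- one-step formulas
  have step : ∀ t,
      (j t = a ∧ δ (t + 1) a = δ t a ∧ δ (t + 1) b = δ t b + δ t a ∧ δ (t + 1) c = δ t c + δ t a ∧ δ (t + 1) e = δ t e + δ t a) ∨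
      (j t = b ∧ δ (t + 1) b = δ t b ∧ δ (t + 1) a = δ t a + δ t b ∧ δ (t + 1) c = δ t c + δ t b ∧ δ (t + 1) e = δ t e + δ t b) ∨
      (j t = c ∧ δ (t + 1) c = δ t c ∧ δ (t + 1) a = δ t a + δ t c ∧ δ (t + 1) b = δ t b + δ t c ∧ δ (t + 1) e = δ t e + δ t c) ∨
      (j t = e ∧ δ (t + 1) e = δ t e ∧ δ (t + 1) a = δ t a + δ t e ∧ δ (t + 1) b = δ t b + δ t e ∧ δ (t + 1) c = δ t c + δ t e) := by
    intro t
    rcases hj t with h | h | h | h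
    · refine Or.inl ⟨h, ?_, ?_, ?_, ?_⟩
      · have := hfix t; rwa [h] at this
      · have := hadd t b (by rw [h]; exact hab.symm); rwa [h] at this
      · have := hadd t c (by rw [h]; exact hac.symm); rwa [h] at this
      · have := hadd t e (by rw [h]; exact hae.symm); rwa [h] at this
    · refine Or.inr (Or.inl ⟨h, ?_, ?_, ?_, ?_⟩)
      · have := hfix t; rwa [h] at this
      · have := hadd t a (by rw [h]; exact hab); rwa [h] at this
      · have := hadd t c (by rw [h]; exact hbc.symm); rwa [h] at this
      · have := hadd t e (by rw [h]; exact hbe.symm); rwa [h] at this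
    · refine Or.inr (Or.inr (Or.inl ⟨h, ?_, ?_, ?_, ?_⟩))
      · have := hfix t; rwa [h] at this
      · have := hadd t a (by rw [h]; exact hac); rwa [h] at this
      · have := hadd t b (by rw [h]; exact hbc); rwa [h] at this
      · have := hadd t e (by rw [h]; exact hce.symm); rwa [h] at this
    · refine Or.inr (Or.inr (Or.inr ⟨h, ?_, ?_, ?_, ?_⟩))
      · have := hfix t; rwa [h] at this
      · have := hadd t a (by rw [h]; exact hae); rwa [h] at this
      · have := hadd t b (by rw [h]; exact hbe); rwa [h] at this
      · have := hadd t c (by rw [h]; exact hce); rwa [h] at this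
  -- the potential
  set H : ℕ → ℤ := fun t => (δ t a + δ t b + δ t c + δ t e) ^ 2 - 3 * (δ t a ^ 2 + δ t b ^ 2 + δ t c ^ 2 + δ t e ^ 2)
    with hHdef
  have hpot : ∀ t, H (t + 1) = H t + 6 * δ t (j t) ^ 2 := by
    intro t
    simp only [hHdef]
    rcases step t with ⟨h, h1, h2, h3, h4⟩ | ⟨h, h1, h2, h3, h4⟩ | ⟨h, h1, h2, h3, h4⟩ | ⟨h, h1, h2, h3, h4⟩ <;>
      · rw [h1, h2, h3, h4, h]; ring
  have hmono : ∀ t T, t ≤ T → H t ≤ H T := by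
    intro t T htT
    induction T, htT using Nat.le_induction with
    | base => exact le_refl _
    | succ T _ ih => exact ih.trans (by rw [hpot T]; nlinarith [sq_nonneg (δ T (j T))])
  -- escaped states are absorbing
  have hesc : ∀ t, 0 ≤ δ t a ∧ 0 ≤ δ t b ∧ 0 ≤ δ t c ∧ 0 ≤ δ t e →
      ∀ T, t ≤ T → 0 ≤ δ T a ∧ 0 ≤ δ T b ∧ 0 ≤ δ T c ∧ 0 ≤ δ T e := by
    intro t ht T htT
    induction T, htT using Nat.le_induction with
    | base => exact ht
    | succ T _ ih =>
      obtain ⟨iha, ihb, ihc, ihe⟩ := ih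
      rcases step T with ⟨-, h1, h2, h3, h4⟩ | ⟨-, h1, h2, h3, h4⟩ | ⟨-, h1, h2, h3, h4⟩ | ⟨-, h1, h2, h3, h4⟩
      · rw [h1, h2, h3, h4]; exact ⟨iha, add_nonneg ihb iha, add_nonneg ihc iha, add_nonneg ihe iha⟩
      · rw [h1, h2, h3, h4]; exact ⟨add_nonneg iha ihb, ihb, add_nonneg ihc ihb, add_nonneg ihe ihb⟩
      · rw [h1, h2, h3, h4]; exact ⟨add_nonneg iha ihc, add_nonneg ihb ihc, ihc, add_nonneg ihe ihc⟩
      · rw [h1, h2, h3, h4]; exact ⟨add_nonneg iha ihe, add_nonneg ihb ihe, add_nonneg ihc ihe, ihe⟩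
  by_cases hE : ∃ t, 0 ≤ δ t a ∧ 0 ≤ δ t b ∧ 0 ≤ δ t c ∧ 0 ≤ δ t e
  · obtain ⟨t, ht⟩ := hE
    exact ⟨t, hesc t ht⟩
  push Not at hE
  exfalso
  -- doomed states: all `≤ 0`; they persist coordinatewise
  have hdoom_persist : ∀ t, δ t a ≤ 0 ∧ δ t b ≤ 0 ∧ δ t c ≤ 0 ∧ δ t e ≤ 0 →
      ∀ T, t ≤ T → δ T a ≤ δ t a ∧ δ T b ≤ δ t b ∧ δ T c ≤ δ t c ∧ δ T e ≤ δ t e := by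
    intro t ht T htT
    induction T, htT using Nat.le_induction with
    | base => exact ⟨le_refl _, le_refl _, le_refl _, le_refl _⟩
    | succ T _ ih =>
      obtain ⟨iha, ihb, ihc, ihe⟩ := ih
      rcases step T with ⟨-, h1, h2, h3, h4⟩ | ⟨-, h1, h2, h3, h4⟩ | ⟨-, h1, h2, h3, h4⟩ | ⟨-, h1, h2, h3, h4⟩
      · rw [h1, h2, h3, h4]; exact ⟨iha, by linarith [ht.1], by linarith [ht.1], by linarith [ht.1]⟩
      · rw [h1, h2, h3, h4]; exact ⟨by linarith [ht.2.1], ihb, by linarith [ht.2.1], by linarith [ht.2.1]⟩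
      · rw [h1, h2, h3, h4]; exact ⟨by linarith [ht.2.2.1], by linarith [ht.2.2.1], ihc, by linarith [ht.2.2.1]⟩
      · rw [h1, h2, h3, h4]; exact ⟨by linarith [ht.2.2.2], by linarith [ht.2.2.2], by linarith [ht.2.2.2], ihe⟩
  by_cases hD : ∃ t, δ t a ≤ 0 ∧ δ t b ≤ 0 ∧ δ t c ≤ 0 ∧ δ t e ≤ 0
  · obtain ⟨t₀, ht₀⟩ := hD
    have hneg : δ t₀ a ≤ -1 ∨ δ t₀ b ≤ -1 ∨ δ t₀ c ≤ -1 ∨ δ t₀ e ≤ -1 := by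
      have h := hE t₀
      by_contra hcon
      push Not at hcon
      exact absurd (h (by omega) (by omega) (by omega)) (by omega)
    -- after the negative letter is charted, all four are `≤ −1`
    obtain ⟨t₁, hall⟩ : ∃ t₁, δ t₁ a ≤ -1 ∧ δ t₁ b ≤ -1 ∧ δ t₁ c ≤ -1 ∧ δ t₁ e ≤ -1 := by
      rcases hneg with hn | hn | hn | hn
      · obtain ⟨t, ht, hjt⟩ := ha t₀
        have hp := hdoom_persist t₀ ht₀ t ht
        rcases step t with ⟨-, h1, h2, h3, h4⟩ | ⟨h, -⟩ | ⟨h, -⟩ | ⟨h, -⟩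
        · exact ⟨t + 1, by rw [h1]; linarith [hp.1], by rw [h2]; linarith [hp.1, hp.2.1, ht₀.2.1],
            by rw [h3]; linarith [hp.1, hp.2.2.1, ht₀.2.2.1], by rw [h4]; linarith [hp.1, hp.2.2.2, ht₀.2.2.2]⟩
        · exact absurd (hjt.symm.trans h) hab
        · exact absurd (hjt.symm.trans h) hac
        · exact absurd (hjt.symm.trans h) hae
      · obtain ⟨t, ht, hjt⟩ := hb t₀
        have hp := hdoom_persist t₀ ht₀ t ht
        rcases step t with ⟨h, -⟩ | ⟨-, h1, h2, h3, h4⟩ | ⟨h, -⟩ | ⟨h, -⟩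
        · exact absurd (hjt.symm.trans h) hab.symm
        · exact ⟨t + 1, by rw [h2]; linarith [hp.1, hp.2.1, ht₀.1], by rw [h1]; linarith [hp.2.1],
            by rw [h3]; linarith [hp.2.1, hp.2.2.1, ht₀.2.2.1], by rw [h4]; linarith [hp.2.1, hp.2.2.2, ht₀.2.2.2]⟩
        · exact absurd (hjt.symm.trans h) hbc
        · exact absurd (hjt.symm.trans h) hbe
      · obtain ⟨t, ht, hjt⟩ := hc t₀
        have hp := hdoom_persist t₀ ht₀ t ht
        rcases step t with ⟨h, -⟩ | ⟨h, -⟩ | ⟨-, h1, h2, h3, h4⟩ | ⟨h, -⟩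
        · exact absurd (hjt.symm.trans h) hac.symm
        · exact absurd (hjt.symm.trans h) hbc.symm
        · exact ⟨t + 1, by rw [h2]; linarith [hp.1, hp.2.2.1, ht₀.1], by rw [h3]; linarith [hp.2.1, hp.2.2.1, ht₀.2.1],
            by rw [h1]; linarith [hp.2.2.1], by rw [h4]; linarith [hp.2.2.1, hp.2.2.2, ht₀.2.2.2]⟩
        · exact absurd (hjt.symm.trans h) hce
      · obtain ⟨t, ht, hjt⟩ := he t₀
        have hp := hdoom_persist t₀ ht₀ t ht
        rcases step t with ⟨h, -⟩ | ⟨h, -⟩ | ⟨h, -⟩ | ⟨-, h1, h2, h3, h4⟩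
        · exact absurd (hjt.symm.trans h) hae.symm
        · exact absurd (hjt.symm.trans h) hbe.symm
        · exact absurd (hjt.symm.trans h) hce.symm
        · exact ⟨t + 1, by rw [h2]; linarith [hp.1, hp.2.2.2, ht₀.1], by rw [h3]; linarith [hp.2.1, hp.2.2.2, ht₀.2.1],
            by rw [h4]; linarith [hp.2.2.1, hp.2.2.2, ht₀.2.2.1], by rw [h1]; linarith [hp.2.2.2]⟩
    -- from `t₁` on the sum drops by at least `3` each step
    have hdrop : ∀ n : ℕ, δ (t₁ + n) a + δ (t₁ + n) b + δ (t₁ + n) c + δ (t₁ + n) e ≤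
        δ t₁ a + δ t₁ b + δ t₁ c + δ t₁ e - 3 * n ∧
        δ (t₁ + n) a ≤ -1 ∧ δ (t₁ + n) b ≤ -1 ∧ δ (t₁ + n) c ≤ -1 ∧ δ (t₁ + n) e ≤ -1 := by
      intro n
      induction n with
      | zero => simpa using hall
      | succ n ih =>
        obtain ⟨ihs, iha, ihb, ihc, ihe⟩ := ih
        rw [show t₁ + (n + 1) = t₁ + n + 1 by ring]
        rcases step (t₁ + n) with ⟨-, h1, h2, h3, h4⟩ | ⟨-, h1, h2, h3, h4⟩ | ⟨-, h1, h2, h3, h4⟩ | ⟨-, h1, h2, h3, h4⟩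
        · rw [h1, h2, h3, h4]; push_cast; exact ⟨by linarith, iha, by linarith, by linarith, by linarith⟩
        · rw [h1, h2, h3, h4]; push_cast; exact ⟨by linarith, by linarith, ihb, by linarith, by linarith⟩
        · rw [h1, h2, h3, h4]; push_cast; exact ⟨by linarith, by linarith, by linarith, ihc, by linarith⟩
        · rw [h1, h2, h3, h4]; push_cast; exact ⟨by linarith, by linarith, by linarith, by linarith, ihe⟩
    obtain ⟨n, hn⟩ : ∃ n : ℕ, δ t₁ a + δ t₁ b + δ t₁ c + δ t₁ e - 4 * B < 3 * n :=
      ⟨(δ t₁ a + δ t₁ b + δ t₁ c + δ t₁ e - 4 * B).natAbs + 1, by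
        push_cast
        linarith [le_abs_self (δ t₁ a + δ t₁ b + δ t₁ c + δ t₁ e - 4 * B),
          abs_nonneg (δ t₁ a + δ t₁ b + δ t₁ c + δ t₁ e - 4 * B)]⟩
    have h1 := (hdrop n).1
    have h2 := hB (t₁ + n)
    linarith [h2.1, h2.2.1, h2.2.2.1, h2.2.2.2]
  push Not at hD
  -- every state is MIXED: the potential is `≤ −1` for ever, yet it grows without bound
  have hmix : ∀ t, H t ≤ -1 := by
    intro t
    have h1 := hE t
    have h2 := hD t
    have hneg : δ t a ≤ -1 ∨ δ t b ≤ -1 ∨ δ t c ≤ -1 ∨ δ t e ≤ -1 := by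
      by_contra hcon; push Not at hcon
      exact absurd (h1 (by omega) (by omega) (by omega)) (by omega)
    have hpos : 1 ≤ δ t a ∨ 1 ≤ δ t b ∨ 1 ≤ δ t c ∨ 1 ≤ δ t e := by
      by_contra hcon; push Not at hcon
      exact absurd (h2 (by omega) (by omega) (by omega)) (by omega)
    simp only [hHdef]
    rcases hneg with hn | hn | hn | hn <;> rcases hpos with hq | hq | hq | hq
    · omega
    · have := pureCorner_potential_four_neg (z := δ t c) (u := δ t e) hn hq; linarith
    · have := pureCorner_potential_four_neg (z := δ t b) (u := δ t e) hn hq; linarith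
    · have := pureCorner_potential_four_neg (z := δ t b) (u := δ t c) hn hq; linarith
    · have := pureCorner_potential_four_neg (z := δ t c) (u := δ t e) hn hq; linarith
    · omega
    · have := pureCorner_potential_four_neg (z := δ t a) (u := δ t e) hn hq; linarith
    · have := pureCorner_potential_four_neg (z := δ t a) (u := δ t c) hn hq; linarith
    · have := pureCorner_potential_four_neg (z := δ t b) (u := δ t e) hn hq; linarith
    · have := pureCorner_potential_four_neg (z := δ t a) (u := δ t e) hn hq; linarith
    · omega
    · have := pureCorner_potential_four_neg (z := δ t a) (u := δ t b) hn hq; linarith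
    · have := pureCorner_potential_four_neg (z := δ t b) (u := δ t c) hn hq; linarith
    · have := pureCorner_potential_four_neg (z := δ t a) (u := δ t c) hn hq; linarith
    · have := pureCorner_potential_four_neg (z := δ t a) (u := δ t b) hn hq; linarith
    · omega
  -- non-zero charted values occur beyond every time (else the state freezes at an escaped one)
  have hnz : ∀ T, ∃ t, T ≤ t ∧ δ t (j t) ≠ 0 := by
    intro T
    by_contra hno
    push Not at hno
    have hconst : ∀ t, T ≤ t → δ t a = δ T a ∧ δ t b = δ T b ∧ δ t c = δ T c ∧ δ t e = δ T e := by
      intro t ht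
      induction t, ht using Nat.le_induction with
      | base => exact ⟨rfl, rfl, rfl, rfl⟩
      | succ t ht ih =>
        have h0 := hno t ht
        rcases step t with ⟨h, h1, h2, h3, h4⟩ | ⟨h, h1, h2, h3, h4⟩ | ⟨h, h1, h2, h3, h4⟩ | ⟨h, h1, h2, h3, h4⟩
        · have h0' : δ t a = 0 := by rw [← h]; exact h0
          exact ⟨by rw [h1]; exact ih.1, by rw [h2, h0', add_zero]; exact ih.2.1,
            by rw [h3, h0', add_zero]; exact ih.2.2.1, by rw [h4, h0', add_zero]; exact ih.2.2.2⟩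
        · have h0' : δ t b = 0 := by rw [← h]; exact h0
          exact ⟨by rw [h2, h0', add_zero]; exact ih.1, by rw [h1]; exact ih.2.1,
            by rw [h3, h0', add_zero]; exact ih.2.2.1, by rw [h4, h0', add_zero]; exact ih.2.2.2⟩
        · have h0' : δ t c = 0 := by rw [← h]; exact h0
          exact ⟨by rw [h2, h0', add_zero]; exact ih.1, by rw [h3, h0', add_zero]; exact ih.2.1,
            by rw [h1]; exact ih.2.2.1, by rw [h4, h0', add_zero]; exact ih.2.2.2⟩
        · have h0' : δ t e = 0 := by rw [← h]; exact h0
          exact ⟨by rw [h2, h0', add_zero]; exact ih.1, by rw [h3, h0', add_zero]; exact ih.2.1,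
            by rw [h4, h0', add_zero]; exact ih.2.2.1, by rw [h1]; exact ih.2.2.2⟩
    obtain ⟨ta, hta, hja⟩ := ha T
    obtain ⟨tb, htb, hjb⟩ := hb T
    obtain ⟨tc, htc, hjc⟩ := hc T
    obtain ⟨te, hte, hje⟩ := he T
    have hza : δ T a = 0 := by rw [← (hconst ta hta).1, ← hja]; exact hno ta hta
    have hzb : δ T b = 0 := by rw [← (hconst tb htb).2.1, ← hjb]; exact hno tb htb
    have hzc : δ T c = 0 := by rw [← (hconst tc htc).2.2.1, ← hjc]; exact hno tc htc
    have hze : δ T e = 0 := by rw [← (hconst te hte).2.2.2, ← hje]; exact hno te hte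
    have h := hE T (by rw [hza]) (by rw [hzb]) (by rw [hzc])
    rw [hze] at h
    exact lt_irrefl _ h
  have hgrow : ∀ n : ℕ, ∃ t, H 0 + n ≤ H t := by
    intro n
    induction n with
    | zero => exact ⟨0, by simp⟩
    | succ n ih =>
      obtain ⟨t, ht⟩ := ih
      obtain ⟨t', htt', hne⟩ := hnz t
      refine ⟨t' + 1, ?_⟩
      have h1 := hmono t t' htt'
      have h2 : 1 ≤ δ t' (j t') ^ 2 := by
        have : δ t' (j t') ≤ -1 ∨ 1 ≤ δ t' (j t') := by omega
        rcases this with h | h <;> nlinarith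
      rw [hpot t']
      push_cast
      linarith
  obtain ⟨t, ht⟩ := hgrow ((H 0).natAbs + 1)
  have h := hmix t
  push_cast at ht
  linarith [neg_abs_le (H 0)]

end ResCone

end Summit.ResolutionOfSingularities.ResolutionOfSingularities.Theorems.PIDim4
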